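import Literature.Probability.RandomPlanarGeometry.HexSAWPolygonSupermult
import Literature.Probability.RandomPlanarGeometry.SAWTriangularPolygonClasses
import Literature.Probability.RandomPlanarGeometry.SAWWidePolygons
import HarnessLib

/-!
# Rooted honeycomb polygons as edge sets: the closing brick-wall walks `HexBW.PolygonConcat.endAt n e₀` trace polygons; canonical traversals are
# translation-rigid (LINE «HEX-MADRAS», the walk ↔ edge-set dictionary)

Topic `Literature/Probability/RandomPlanarGeometry` (lane «pcv-sawmu», a-p4 g13; the honeycomb twin of the tree's `SAWTriangularPolygonLoopEdges.lean`
(`isPolygon_brickLoopEdges`, `eq_of_shiftEdges_brickLoopEdges` for the triangular brick frame) — same statements and proofs for the brick wall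
`brickWallGraph`, the rooted polygons `HexBW.PolygonConcat.endAt n e₀` of `HexSAWPolygonConcatenation.lean` and the canonical traversals
`HexBW.PolygonConcat.canonEnd n` of `HexSAWPolygonSupermult.lean` (`#canonEnd n = q_{n+1}(ℍ)`); the edge set `brickLoopEdges n ρ` (the `n` bonds of
`ρ` and the closing bond `{ρ n, 0}`) and `vertsOf_brickLoopEdges` are the generic ones of `SAWTriangularPolygonCount/Classes.lean`; edge-set
translation `shiftEdges` is the tree's).

Source frame: N. Madras, G. Slade, *The Self-Avoiding Walk* (1993), §3.2, Definition 3.2.1 p. 62 (a polygon as a set of bonds) and eq. (3.2.1) p. 63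
(rooted oriented traversals vs. polygons; one representative per translation class, Definition 3.2.2).  Used by the edge-set form of Madras' join on
`ℍ` (A. Hammond, arXiv:1504.05286v5, Definition 4.3 p. 20), whose junctions (`HexSAWPolygonJunctions.lean`) are stated for `IsPolygon brickWallGraph`.

## Contents (namespace `…SAW.HexBW.PolygonConcat`; all proved)
* `isPolygon_brickLoopEdges_of_mem_endAt`, `card_brickLoopEdges_of_mem_endAt`, `vertsOf_brickLoopEdges_of_mem_endAt`;
* `eq_or_eq_of_mem_brickLoopEdges_of_mem_endAt` (the polygon neighbours of an interior vertex), `eq_of_brickLoopEdges_eq_of_apply_one`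
  (edge set + first step determine the traversal), **`eq_of_brickLoopEdges_eq_of_mem_canonEnd`** (canonical traversals with the same edge set coincide);
* `isPolygon_shiftEdges_of_even` (an EVEN translate of a honeycomb polygon is a honeycomb polygon);
* **`eq_of_shiftEdges_brickLoopEdges_of_mem_canonEnd`** — translation rigidity: if the edge set of a canonical traversal is a translate of the
  edge set of another (same `n ≥ 2`), the two coincide and the translation is `0`.

Consumers (LINE «HEX-MADRAS»): `HexSAWPolygonEdgeCanon.lean` (`exists_canonEnd_of_isPolygon`), `HexSAWPolygonJoinAssembly.lean` (the join map is
injective on canonical traversals: `eq_of_shiftEdges_brickLoopEdges_of_mem_canonEnd`), and `isPolygon_shiftEdges_of_even` in every `juK`.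
ed.2 (a-p4 g14) = ed.1 a662ce0b80ccc8af + this paragraph (no code change).
-/

noncomputable section

open SimpleGraph Finset Literature.Probability.LatticeModels Literature.Probability.Percolation
open Literature.Barriers.CriticalPhenomena.SupercriticalSAW (shiftEdges card_shiftEdges mem_shiftEdges_iff shiftEdges_injective)
open Literature.Probability.Percolation.SiteGadgetSystem (vertsOf mem_vertsOf)

namespace Literature.Probability.RandomPlanarGeometry.SAW

namespace HexBW

namespace PolygonConcat

variable {n : ℕ} {ω ζ : ℕ → Site 2}

/-! ### The rooted polygon as an edge set -/

/-- The edge list of `Zd.walkOfFn ω n` (private plumbing). [folklore] -/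
private theorem edges_walkOfFn' {V : Type*} {G : SimpleGraph V} (ω : ℕ → V) (n : ℕ) (h : ∀ i < n, G.Adj (ω i) (ω (i + 1))) :
    (Zd.walkOfFn ω n h).edges = (List.range n).map fun i => s(ω i, ω (i + 1)) := by
  induction n generalizing ω with
  | zero => rfl
  | succ n ih =>
    rw [Zd.walkOfFn, Walk.edges_cons, ih, List.range_succ_eq_map, List.map_cons, List.map_map]
    rfl

/-- unfolded membership in `endAt n e₀` (private plumbing). [cite: MadrasSlade1993, §3.2 (3.2.1) p. 63] -/
private theorem facts_of_mem_endAt (hω : ω ∈ endAt n (Pi.single 0 1 : Site 2)) :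
    ω 0 = 0 ∧ (∀ i, n ≤ i → ω i = ω n) ∧ (∀ i < n, brickWallGraph.Adj (ω i) (ω (i + 1))) ∧ Set.InjOn ω {i | i ≤ n} ∧
      ω n = (Pi.single 0 1 : Site 2) := by
  obtain ⟨⟨h0, hfroz, hadj, hinj⟩, hend⟩ := mem_endAt_iff.1 hω
  exact ⟨h0, hfroz, hadj, hinj, hend⟩

/-- **A rooted honeycomb polygon traces a polygon**: for `ω ∈ endAt n e₀` (`n ≥ 2`) the edge set `brickLoopEdges n ω` (the `n` bonds of `ω` and the
closing bond `{e₀, 0}`) is the edge set of a cycle of the brick wall. [cite: MadrasSlade1993, Definition 3.2.1 p. 62] -/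
theorem isPolygon_brickLoopEdges_of_mem_endAt (hn : 2 ≤ n) (hω : ω ∈ endAt n (Pi.single 0 1 : Site 2)) :
    IsPolygon brickWallGraph (brickLoopEdges n ω) := by
  classical
  obtain ⟨h0, -, hadj, hinj, -⟩ := facts_of_mem_endAt hω
  have hlast : brickWallGraph.Adj (ω n) (ω 0) := adj_last_zero hω
  set p : brickWallGraph.Walk (ω 0) (ω n) := Zd.walkOfFn ω n hadj with hp
  have hpath : p.IsPath := by
    rw [← Walk.IsPath.getVert_injOn_iff]
    intro i hi j hj hij
    simp only [Set.mem_setOf_eq, hp, Zd.length_walkOfFn] at hi hj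
    simp only [hp, Zd.getVert_walkOfFn, min_eq_left hi, min_eq_left hj] at hij
    exact hinj hi hj hij
  have hedges : p.edges = (List.range n).map fun i => s(ω i, ω (i + 1)) := by rw [hp, edges_walkOfFn']
  have hnot : s(ω n, ω 0) ∉ p.edges := by
    rw [hedges, List.mem_map]
    rintro ⟨i, hi, he⟩
    rw [List.mem_range] at hi
    rcases Sym2.eq_iff.1 he with ⟨h1, -⟩ | ⟨h1, h2⟩
    · have := hinj (show i ∈ {i | i ≤ n} by simp; omega) (show n ∈ {i | i ≤ n} by simp) h1
      omega
    · have := hinj (show i ∈ {i | i ≤ n} by simp; omega) (show 0 ∈ {i | i ≤ n} by simp) h1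
      have := hinj (show i + 1 ∈ {i | i ≤ n} by simp; omega) (show n ∈ {i | i ≤ n} by simp) h2
      omega
  refine ⟨ω n, Walk.cons hlast p, (Walk.cons_isCycle_iff p hlast).2 ⟨hpath, hnot⟩, ?_⟩
  rw [Walk.edges_cons, List.toFinset_cons, hedges, brickLoopEdges, h0]
  congr 1

/-- `brickLoopEdges n ω` has `n + 1` bonds for `ω ∈ endAt n e₀`, `n ≥ 2`. [cite: MadrasSlade1993, Definition 3.2.1 p. 62] -/
theorem card_brickLoopEdges_of_mem_endAt (hn : 2 ≤ n) (hω : ω ∈ endAt n (Pi.single 0 1 : Site 2)) :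
    #(brickLoopEdges n ω) = n + 1 := by
  classical
  obtain ⟨h0, -, -, hinj, -⟩ := facts_of_mem_endAt hω
  have hinj' : Set.InjOn (fun i => s(ω i, ω (i + 1))) ↑(range n) := by
    intro i hi j hj hij
    rw [Finset.coe_range, Set.mem_Iio] at hi hj
    rcases Sym2.eq_iff.1 hij with ⟨h1, -⟩ | ⟨h1, h2⟩
    · exact hinj (show i ∈ {i | i ≤ n} by simp; omega) (show j ∈ {i | i ≤ n} by simp; omega) h1
    · have a := hinj (show i ∈ {i | i ≤ n} by simp; omega) (show j + 1 ∈ {i | i ≤ n} by simp; omega) h1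
      have b := hinj (show i + 1 ∈ {i | i ≤ n} by simp; omega) (show j ∈ {i | i ≤ n} by simp; omega) h2
      omega
  have hnot : s(ω n, (0 : Site 2)) ∉ (range n).image fun i => s(ω i, ω (i + 1)) := by
    rw [Finset.mem_image]
    rintro ⟨i, hi, he⟩
    rw [Finset.mem_range] at hi
    rcases Sym2.eq_iff.1 he with ⟨h1, -⟩ | ⟨h1, h2⟩
    · have := hinj (show i ∈ {i | i ≤ n} by simp; omega) (show n ∈ {i | i ≤ n} by simp) h1
      omega
    · have := hinj (show i ∈ {i | i ≤ n} by simp; omega) (show 0 ∈ {i | i ≤ n} by simp) (h1.trans h0.symm)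
      have := hinj (show i + 1 ∈ {i | i ≤ n} by simp; omega) (show n ∈ {i | i ≤ n} by simp) h2
      omega
  rw [brickLoopEdges, Finset.card_insert_of_notMem hnot, Finset.card_image_of_injOn hinj', Finset.card_range]

/-- The vertices of `brickLoopEdges n ω` are the sites `ω 0, …, ω n`. [cite: MadrasSlade1993, Definition 3.2.1 p. 62] -/
theorem vertsOf_brickLoopEdges_of_mem_endAt (hn : 1 ≤ n) (hω : ω ∈ endAt n (Pi.single 0 1 : Site 2)) :
    vertsOf (brickLoopEdges n ω) = (range (n + 1)).image ω :=
  vertsOf_brickLoopEdges (facts_of_mem_endAt hω).1 hn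

/-! ### The edge set determines the traversal -/

/-- The polygon-neighbours of an interior vertex `ω i` (`1 ≤ i ≤ n−1`) are `ω (i−1)` and `ω (i+1)`. [cite: MadrasSlade1993, Definition 3.2.1 p. 62] -/
theorem eq_or_eq_of_mem_brickLoopEdges_of_mem_endAt {i : ℕ} (hω : ω ∈ endAt n (Pi.single 0 1 : Site 2)) (hi1 : 1 ≤ i)
    (hin : i + 1 ≤ n) {x : Site 2} (hx : s(ω i, x) ∈ brickLoopEdges n ω) : x = ω (i - 1) ∨ x = ω (i + 1) := by
  obtain ⟨h0, -, -, hinj, -⟩ := facts_of_mem_endAt hω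
  have hI : ∀ {a b : ℕ}, a ≤ n → b ≤ n → ω a = ω b → a = b := fun ha hb h =>
    hinj (show _ ∈ {i | i ≤ n} by simpa using ha) (show _ ∈ {i | i ≤ n} by simpa using hb) h
  rcases mem_brickLoopEdges.1 hx with h | ⟨j, hj, h⟩
  · rcases Sym2.eq_iff.1 h with ⟨h1, -⟩ | ⟨h1, -⟩
    · have := hI (by omega) le_rfl h1; omega
    · rw [← h0] at h1; have := hI (by omega) (by omega) h1; omega
  · rcases Sym2.eq_iff.1 h with ⟨h1, h2⟩ | ⟨h1, h2⟩
    · have := hI (by omega) (by omega) h1; subst this; exact Or.inr h2.symm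
    · have := hI (by omega) (by omega) h2
      have hj' : j = i - 1 := by omega
      subst hj'
      exact Or.inl h1.symm

/-- Two rooted honeycomb polygons with the same edge set and the same first step coincide. [cite: MadrasSlade1993, §3.2, eq. (3.2.1) p. 63] -/
theorem eq_of_brickLoopEdges_eq_of_apply_one (hω : ω ∈ endAt n (Pi.single 0 1 : Site 2)) (hζ : ζ ∈ endAt n (Pi.single 0 1 : Site 2))
    (hE : brickLoopEdges n ζ = brickLoopEdges n ω) (h1 : ζ 1 = ω 1) : ζ = ω := by
  obtain ⟨h0, hfroz, -, -, -⟩ := facts_of_mem_endAt hω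
  obtain ⟨h0', hfroz', -, hinj', -⟩ := facts_of_mem_endAt hζ
  have key : ∀ i, i ≤ n → ζ i = ω i := by
    intro i
    induction i using Nat.strong_induction_on with
    | _ i ih =>
      intro hi
      rcases Nat.lt_or_ge i 2 with hi2 | hi2
      · interval_cases i
        · rw [h0, h0']
        · exact h1
      · have hprev : ζ (i - 1) = ω (i - 1) := ih (i - 1) (by omega) (by omega)
        have hprev2 : ζ (i - 2) = ω (i - 2) := ih (i - 2) (by omega) (by omega)
        have hmem : s(ω (i - 1), ζ i) ∈ brickLoopEdges n ω := by
          rw [← hE, ← hprev, mem_brickLoopEdges]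
          exact Or.inr ⟨i - 1, by omega, by rw [show i - 1 + 1 = i by omega]⟩
        rcases eq_or_eq_of_mem_brickLoopEdges_of_mem_endAt hω (by omega) (by omega) hmem with h | h
        · rw [show i - 1 - 1 = i - 2 by omega, ← hprev2] at h
          have := hinj' (show i ∈ {i | i ≤ n} by simpa using hi)
            (show i - 2 ∈ {i | i ≤ n} by simp only [Set.mem_setOf_eq]; omega) h
          omega
        · rwa [show i - 1 + 1 = i by omega] at h
  funext i
  rcases le_or_gt i n with hi | hi
  · exact key i hi
  · rw [hfroz i hi.le, hfroz' i hi.le, key n le_rfl]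

/-- **Canonical traversals with the same edge set coincide** (their first step is `(0,1)` by `apply_one_of_mem_canonEnd`).
[cite: MadrasSlade1993, Definition 3.2.2 and eq. (3.2.1) p. 63 (one representative per class)] -/
theorem eq_of_brickLoopEdges_eq_of_mem_canonEnd (hn : 2 ≤ n) (hω : ω ∈ canonEnd n) (hζ : ζ ∈ canonEnd n)
    (hE : brickLoopEdges n ζ = brickLoopEdges n ω) : ζ = ω := by
  have h1 : ζ 1 = ω 1 := by
    have a := apply_one_of_mem_canonEnd hω hn
    have b := apply_one_of_mem_canonEnd hζ hn
    funext i; fin_cases i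
    · exact b.1.trans a.1.symm
    · exact b.2.trans a.2.symm
  exact eq_of_brickLoopEdges_eq_of_apply_one (mem_canonEnd.1 hω).1 (mem_canonEnd.1 hζ).1 hE h1

/-! ### Even translates -/

/-- The translation `x ↦ x + t` by an EVEN vector is a graph homomorphism of the brick wall (indeed an automorphism).
[cite: EntingJensen2009, §7.4.2, Fig. 7.10 (brickwork form of the honeycomb lattice: two sites per fundamental domain)] -/
def addHom (t : Site 2) (ht : (t 0 + t 1) % 2 = 0) : brickWallGraph →g brickWallGraph where
  toFun x := x + t
  map_rel' {x y} h := (adj_add_iff_of_even ht x y).2 h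

/-- **An even translate of a honeycomb polygon is a honeycomb polygon.** [cite: MadrasSlade1993, Definition 3.2.2 p. 63 (polygons up to translation); EntingJensen2009, §7.4.2, Fig. 7.10] -/
theorem isPolygon_shiftEdges_of_even {E : Finset (Sym2 (Site 2))} (hE : IsPolygon brickWallGraph E) {t : Site 2}
    (ht : (t 0 + t 1) % 2 = 0) : IsPolygon brickWallGraph (shiftEdges t E) := by
  classical
  obtain ⟨u, c, hc, rfl⟩ := hE
  have hinj : Function.Injective (addHom t ht) := fun x y h => add_right_cancel (a := x) (b := t) (c := y) h
  refine ⟨addHom t ht u, c.map (addHom t ht), (Walk.isCycle_map_iff_of_injective hinj).2 hc, ?_⟩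
  rw [Walk.edges_map, shiftEdges]
  ext e
  simp only [List.mem_toFinset, List.mem_map, Finset.mem_image]
  rfl

/-! ### Translation rigidity of canonical traversals -/

/-- the lexicographic order used by `canonEnd`: `LexNonneg (x − m)` means `m ≤_lex x` (private plumbing). [cite: MadrasSlade1993, Definition 3.2.2 p. 63] -/
private theorem lexNonneg_antisymm {x : Site 2} (h1 : LexNonneg x) (h2 : LexNonneg (-x)) : x = 0 := by
  unfold LexNonneg at h1 h2
  simp only [Pi.neg_apply] at h2
  funext i; fin_cases i
  · show x 0 = 0; omega
  · show x 1 = 0; omega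

/-- **Canonical traversals are translation-rigid**: if the edge set of a canonical traversal `ζ` is a translate of the edge set of a canonical
traversal `ω` (same `n ≥ 2`), then `ζ = ω` and the translation is `0` (the lexicographically smallest vertex of both is the root `0`).
[cite: MadrasSlade1993, Definition 3.2.2 and §3.2 eq. (3.2.1) p. 63 (one representative per translation class)] -/
theorem eq_of_shiftEdges_brickLoopEdges_of_mem_canonEnd (hn : 2 ≤ n) (hω : ω ∈ canonEnd n) (hζ : ζ ∈ canonEnd n) {z : Site 2}
    (h : shiftEdges z (brickLoopEdges n ω) = brickLoopEdges n ζ) : ζ = ω ∧ z = 0 := by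
  classical
  obtain ⟨hωe, hωl⟩ := mem_canonEnd.1 hω
  obtain ⟨hζe, hζl⟩ := mem_canonEnd.1 hζ
  -- vertex sets: `V(ζ) = V(ω) + z`
  have hVω := vertsOf_brickLoopEdges_of_mem_endAt (by omega) hωe
  have hVζ := vertsOf_brickLoopEdges_of_mem_endAt (by omega) hζe
  have hmem : ∀ x, x ∈ vertsOf (brickLoopEdges n ζ) ↔ x - z ∈ vertsOf (brickLoopEdges n ω) := fun x => by
    rw [← h, mem_vertsOf_shiftEdges]
  -- `0 = ζ 0 ∈ V(ζ)` so `−z ∈ V(ω)`, hence `LexNonneg (−z)`; `0 = ω 0 ∈ V(ω)` so `z ∈ V(ζ)`, hence `LexNonneg z`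
  have h0ζ : (0 : Site 2) ∈ vertsOf (brickLoopEdges n ζ) := by
    rw [hVζ, Finset.mem_image]; exact ⟨0, by simp, (facts_of_mem_endAt hζe).1⟩
  have h0ω : (0 : Site 2) ∈ vertsOf (brickLoopEdges n ω) := by
    rw [hVω, Finset.mem_image]; exact ⟨0, by simp, (facts_of_mem_endAt hωe).1⟩
  have hz1 : LexNonneg (-z) := by
    have := (hmem 0).1 h0ζ
    rw [zero_sub, hVω, Finset.mem_image] at this
    obtain ⟨i, hi, he⟩ := this
    rw [← he]; exact hωl i (by simpa using hi)
  have hz2 : LexNonneg z := by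
    have : z ∈ vertsOf (brickLoopEdges n ζ) := by rw [hmem, sub_self]; exact h0ω
    rw [hVζ, Finset.mem_image] at this
    obtain ⟨i, hi, he⟩ := this
    rw [← he]; exact hζl i (by simpa using hi)
  have hz : z = 0 := lexNonneg_antisymm hz2 hz1
  subst hz
  refine ⟨eq_of_brickLoopEdges_eq_of_mem_canonEnd hn hω hζ ?_, rfl⟩
  rw [← h, shiftEdges_zero]

end PolygonConcat

end HexBW

end Literature.Probability.RandomPlanarGeometry.SAW

end
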